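/-
Copyright (c) 2026 the pub-hodgecm-mathlib formalisation cell (harness21).  Prover seat hodgecm-mathlib-K2E2-p12 (g5): Track B «K2-LIT», ENGINE E1,
h413 = stmt-HodgeConjecture-24833; (q10) «R7₃-SCALAR» FILE 2(b) «transport», split part, MEASURE SIDE (α-2) (dealer K2E1-plan (g5) «=» 2026-09-04T08:17:33Z).
-/
import Literature.MeasureTheory.Group.LocalFieldLinearJacobian           -- ★ C6 «linear Jacobian over a local field»: `map_linearEquiv_addHaar` (`μ.map L = mod(det L)⁻¹ • μ` on `ι → F`)
import Literature.NumberTheory.Automorphic.LocalRingUnitModulusProduct    -- ★ `distribHaarChar_eq_normAbs` (`mod_F = ‖·‖_F` on a non-archimedean local field)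
import Literature.NumberTheory.Automorphic.TateLocalZetaShells           -- ★ `map_mul_left_addHaar` (`μ.map (a·) = ‖a⁻¹‖ • μ`); brings `normAbs`, `IsNonarchimedeanLocalField`
import Mathlib.MeasureTheory.Constructions.Pi
import HarnessLib

/-!
# K2·E1 — `K2E1BigCellCoordinateChangeGL3` ((q10) «R7₃-SCALAR» FILE 2(b) split, MEASURE SIDE): THE BIG-CELL COORDINATE CHANGE `(a, b, t) ↦ (x, y, z)` AT A SPLIT PLACE
# PRESERVES HAAR MEASURE ON `F³` — `x = a + δ₁ b`, `y = −(a − δ₁ b)`, `z = δ₁ t − ½ (a + δ₁ b)(a − δ₁ b)`, `‖2‖_F = ‖δ₁‖_F = 1`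

Track B ∕ K2-LIT, crux h413 = `stmt-HodgeConjecture-24833`, route of record `HCCMUnconditional`; cell `hodgecm-mathlib`, squad K2, ENGINE E1 (campaign «EIS-RANK-ONE», R7 at
`N = 3`; (α-2) of the split transport).  THEOREMS ONLY (no `def`, no instance, no notation, no named-fact hypothesis, no `sorry`; default heartbeats); lane
`--supports stmt-HodgeConjecture-24833 --as helper` (count-neutral).  Generic non-archimedean local field `F`, ANY additive Haar measure `μ`, the product measure
`Measure.pi (fun _ : Fin 3 => μ)` on `Fin 3 → F` (the currency of ★ `AdelicProductIntegral` at `ι = Fin 3`).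

THE MATHEMATICS [Tate1950, §2.2; Weil BNT Ch. I §2; Langlands1971, §3].  At a split place the `U(2,1)` big-cell height in the base coordinates `(a, b, t) ∈ (L⁺_v)³` is the
Gindikin–Karpelevich `GL₃` integrand at `(x, y, z) = Φ(a, b, t) := (a + δ₁ b, −(a − δ₁ b), δ₁ t − ½(a + δ₁ b)(a − δ₁ b))` (★ `K2E1IntertwiningLocalFactorU3HeightSplit`, `δ₁ = δ_w` the
square root of `d` at `w`).  `Φ = S ∘ L` with `L` LINEAR of determinant `2δ₁²` (`(a,b,t) ↦ (a + δ₁ b, −a + δ₁ b, δ₁ t)`) and `S` the SHEAR `(x, y, z') ↦ (x, y, z' + ½ x y)`; when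
`2` and `δ₁` are units both preserve the Haar measure `μ ⊗ μ ⊗ μ`: `L` by the linear Jacobian `mod_F(det L) = ‖2δ₁²‖_F = 1` (★ `Literature.MeasureTheory.Group.LocalFieldLinearJacobian`,
★ `distribHaarChar_eq_normAbs`), `S` by Fubini (Mathlib `measurePreserving_piFinSuccAbove` + `MeasurePreserving.skew_product`) and translation invariance of `μ`.  Hence
**`∫_{F³} G(Φ p) dμ³(p) = ∫_{F³} G dμ³`** for EVERY `G` (`Φ` is a measurable equivalence) — the measure side of the split transport: FILE 3 reads the split local factor of the
`U(2,1)` intertwining constant as ★ `K2E1GindikinKarpelevichSplitGL3.integral_bigCell_spherical_gl3_eq` after this change of variables and Fubini.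
* §1 `measurePreserving_shear_fin_three` — `p ↦ update p 2 (p 2 + φ (p 0) (p 1))` preserves `μ³` for every measurable `φ : F → F → F`.
* §2 `measurePreserving_mulVec_of_normAbs_det_eq_one` — `p ↦ M p` preserves `μ³` (any finite `ι`) when `‖det M‖_F = 1`.
* §3 `det_bigCellMatrix`, **`measurePreserving_bigCellChange`**, the explicit inverse `bigCellChange_leftInverse ∕ _rightInverse`, and HEAD **`integral_comp_bigCellChange_eq`**:
  `∫ p, G ![p 0 + δ₁ p 1, −(p 0 − δ₁ p 1), δ₁ p 2 − 2⁻¹ (p 0 + δ₁ p 1)(p 0 − δ₁ p 1)] ∂μ³ = ∫ p, G p ∂μ³`.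
HONEST LABEL: HC_CM is proved only modulo the 7 printed citations (2 remaining named inputs: hLiu418 = `stmt-HodgeConjecture-24832`, h413 = `stmt-HodgeConjecture-24833`) until rung 0
closes; this file asserts no named fact and closes no socket; count-neutral.

## References
* [Tate1950] J. Tate, *Fourier analysis in number fields and Hecke's zeta-functions* (1950): §2.2 Lemma 2.2.5 (`d(αξ) = |α| dξ`).
* [WeilBNT1967] A. Weil, *Basic Number Theory* (1967): Ch. I §2 (the module), Ch. II §5.
* [Langlands1971] R. P. Langlands, *Euler Products* (1971): §3.
-/

set_option autoImplicit false
set_option linter.dupNamespace false -- the mandated namespace repeats `HodgeConjecture.HodgeConjecture`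

noncomputable section

open MeasureTheory MeasureTheory.Measure Filter Topology Set Matrix
open scoped NNReal ENNReal
open Literature.NumberTheory.GaloisRepresentations.IsNonarchimedeanLocalField
open Literature.NumberTheory.Automorphic

namespace Summit.HodgeConjecture.HodgeConjecture.Cruxes.H413.K2E1BigCellCoordinateChangeGL3

variable {F : Type*} [Field F] [ValuativeRel F] [TopologicalSpace F] [IsNonarchimedeanLocalField F]
  [MeasurableSpace F] [BorelSpace F] (μ : Measure F) [μ.IsAddHaarMeasure]

/-! ## §1 The shear `(x, y, z) ↦ (x, y, z + φ(x, y))` preserves `μ³` -/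

/-- **A SHEAR IN THE LAST COORDINATE PRESERVES `μ ⊗ μ ⊗ μ`**: for every measurable `φ : F → F → F`, `p ↦ update p 2 (p 2 + φ (p 0) (p 1))` preserves
`Measure.pi (fun _ : Fin 3 => μ)` — Fubini (`Fin 3 → F ≃ᵐ F × (Fin 2 → F)` separating the coordinate `2`, Mathlib `measurePreserving_piFinSuccAbove`), a skew product with
the identity on the `(x, y)`-factor (`MeasurePreserving.skew_product`), and translation invariance `μ.map (c + ·) = μ`. [cite: WeilBNT1967, Ch. II §5] -/
theorem measurePreserving_shear_fin_three {φ : F → F → F} (hφ : Measurable (Function.uncurry φ)) :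
    MeasurePreserving (fun p : Fin 3 → F => Function.update p 2 (p 2 + φ (p 0) (p 1)))
      (Measure.pi fun _ : Fin 3 => μ) (Measure.pi fun _ : Fin 3 => μ) := by
  haveI := secondCountableTopology_localField F
  haveI := sigmaCompactSpace_of_isNonarchimedeanLocalField F
  set e : (Fin 3 → F) ≃ᵐ F × (Fin 2 → F) := MeasurableEquiv.piFinSuccAbove (fun _ : Fin 3 => F) 2 with he_def
  have he : MeasurePreserving e (Measure.pi fun _ : Fin 3 => μ) (μ.prod (Measure.pi fun _ : Fin 2 => μ)) :=
    measurePreserving_piFinSuccAbove (fun _ : Fin 3 => μ) 2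
  -- the skew product on `(Fin 2 → F) × F`: `(r, t) ↦ (r, φ (r 0) (r 1) + t)`
  have hg : Measurable (Function.uncurry fun (r : Fin 2 → F) (t : F) => φ (r 0) (r 1) + t) := by
    have hf : Measurable fun q : (Fin 2 → F) × F => (q.1 0, q.1 1) :=
      ((measurable_pi_apply 0).comp measurable_fst).prodMk ((measurable_pi_apply 1).comp measurable_fst)
    have h1 : Measurable fun q : (Fin 2 → F) × F => φ (q.1 0) (q.1 1) := hφ.comp hf
    exact h1.add measurable_snd
  have hskew : MeasurePreserving (fun q : (Fin 2 → F) × F => (q.1, φ (q.1 0) (q.1 1) + q.2))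
      ((Measure.pi fun _ : Fin 2 => μ).prod μ) ((Measure.pi fun _ : Fin 2 => μ).prod μ) :=
    (MeasurePreserving.id _).skew_product hg (Eventually.of_forall fun r => map_add_left_eq_self μ _)
  -- conjugate by the swap: `T (t, r) = (φ (r 0) (r 1) + t, r)` preserves `μ.prod μ²`
  have hT : MeasurePreserving (fun q : F × (Fin 2 → F) => (φ (q.2 0) (q.2 1) + q.1, q.2))
      (μ.prod (Measure.pi fun _ : Fin 2 => μ)) (μ.prod (Measure.pi fun _ : Fin 2 => μ)) := by
    have h := (measurePreserving_swap (μ := Measure.pi fun _ : Fin 2 => μ) (ν := μ)).comp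
      (hskew.comp (measurePreserving_swap (μ := μ) (ν := Measure.pi fun _ : Fin 2 => μ)))
    exact h
  -- and back: the shear is `e.symm ∘ T ∘ e`
  have hconj : (fun p : Fin 3 → F => Function.update p 2 (p 2 + φ (p 0) (p 1))) =
      fun p => e.symm ((fun q : F × (Fin 2 → F) => (φ (q.2 0) (q.2 1) + q.1, q.2)) (e p)) := by
    funext p
    apply e.injective
    rw [e.apply_symm_apply]
    have h0 : Fin.succAbove (2 : Fin 3) 0 = 0 := by decide
    have h1 : Fin.succAbove (2 : Fin 3) 1 = 1 := by decide
    refine Prod.ext ?_ ?_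
    · show Function.update p 2 (p 2 + φ (p 0) (p 1)) 2 = φ (p (Fin.succAbove 2 0)) (p (Fin.succAbove 2 1)) + p 2
      rw [Function.update_self, h0, h1, add_comm]
    · funext j
      show Function.update p 2 (p 2 + φ (p 0) (p 1)) (Fin.succAbove 2 j) = p (Fin.succAbove 2 j)
      exact Function.update_of_ne (Fin.succAbove_ne 2 j) _ _
  rw [hconj]
  exact he.symm.comp (hT.comp he)

/-! ## §2 A linear change with unit-norm determinant preserves `μ^ι` -/

/-- **`p ↦ M p` PRESERVES `Measure.pi μ` WHEN `‖det M‖_F = 1`** (`ι` finite): the linear Jacobian over a local field ★ `map_linearEquiv_addHaar` (`μ.map L = mod_F(det L)⁻¹ • μ`)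
with `mod_F = ‖·‖_F` ★ `distribHaarChar_eq_normAbs`. [cite: Tate1950, §2.2 Lemma 2.2.5] [cite: WeilBNT1967, Ch. I §2] -/
theorem measurePreserving_mulVec_of_normAbs_det_eq_one {ι : Type} [Fintype ι] [DecidableEq ι] (M : Matrix ι ι F) (hM : normAbs F M.det = 1) :
    MeasurePreserving (fun p : ι → F => M *ᵥ p) (Measure.pi fun _ : ι => μ) (Measure.pi fun _ : ι => μ) := by
  haveI := secondCountableTopology_localField F
  haveI := sigmaCompactSpace_of_isNonarchimedeanLocalField F
  have hdet : M.det ≠ 0 := by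
    intro h
    rw [h, map_zero] at hM
    exact zero_ne_one hM
  set L : (ι → F) ≃ₗ[F] (ι → F) := Matrix.toLinearEquiv' M (Matrix.invertibleOfIsUnitDet M (Ne.isUnit hdet)) with hL
  have hLM : (fun p : ι → F => M *ᵥ p) = (L : (ι → F) → (ι → F)) := by
    funext p
    rfl
  have hmeas : Measurable (L : (ι → F) → (ι → F)) := by
    rw [← hLM]
    exact Continuous.measurable (continuous_pi fun i => by
      simp only [Matrix.mulVec, dotProduct]
      exact continuous_finsetSum _ fun j _ => continuous_const.mul (continuous_apply j))
  have hdetL : LinearEquiv.det L = Units.mk0 M.det hdet := by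
    ext
    rw [LinearEquiv.coe_det, Units.val_mk0, hL, Matrix.toLinearEquiv'_apply, LinearMap.det_toLin']
  refine ⟨by rw [hLM]; exact hmeas, ?_⟩
  rw [hLM, Literature.MeasureTheory.Group.map_linearEquiv_addHaar (Measure.pi fun _ : ι => μ) L, hdetL,
    UnitaryGroup.distribHaarChar_eq_normAbs, Units.val_mk0, hM, inv_one, one_smul]

/-! ## §3 The big-cell change `Φ(a, b, t) = (a + δ₁ b, −(a − δ₁ b), δ₁ t − ½ (a + δ₁ b)(a − δ₁ b))` -/

omit [ValuativeRel F] [TopologicalSpace F] [IsNonarchimedeanLocalField F] [MeasurableSpace F] [BorelSpace F] in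
/-- The linear part of `Φ` has determinant `2δ₁²`. [folklore] -/
theorem det_bigCellMatrix (δ₁ : F) : (!![(1 : F), δ₁, 0; -1, δ₁, 0; 0, 0, δ₁]).det = 2 * δ₁ ^ 2 := by
  rw [Matrix.det_fin_three]
  simp
  ring

omit [ValuativeRel F] [TopologicalSpace F] [IsNonarchimedeanLocalField F] [MeasurableSpace F] [BorelSpace F] in
/-- The linear part of `Φ` in coordinates: `M p = (p₀ + δ₁ p₁, −(p₀ − δ₁ p₁), δ₁ p₂)`. [folklore] -/
theorem bigCellMatrix_mulVec (δ₁ : F) (p : Fin 3 → F) :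
    !![(1 : F), δ₁, 0; -1, δ₁, 0; 0, 0, δ₁] *ᵥ p = ![p 0 + δ₁ * p 1, -(p 0 - δ₁ * p 1), δ₁ * p 2] := by
  ext i
  fin_cases i
  · simp [Matrix.mulVec, dotProduct, Fin.sum_univ_three]
  · simp [Matrix.mulVec, dotProduct, Fin.sum_univ_three]
    ring
  · simp [Matrix.mulVec, dotProduct, Fin.sum_univ_three]

/-- **`Φ` PRESERVES `μ³`** when `‖2‖_F = ‖δ₁‖_F = 1`: `Φ = S ∘ L`, `L p = M p` with `M = (1, δ₁, 0; −1, δ₁, 0; 0, 0, δ₁)`, `‖det M‖ = ‖2‖‖δ₁‖² = 1` (§2), and `S` the shear by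
`½ x y` in the last coordinate (§1; note `−½(a + δ₁ b)(a − δ₁ b) = ½ x y` for `x = a + δ₁ b`, `y = −(a − δ₁ b)`). [cite: Tate1950, §2.2 Lemma 2.2.5] [cite: Langlands1971, §3] -/
theorem measurePreserving_bigCellChange {δ₁ : F} (hδ : normAbs F δ₁ = 1) (h2 : normAbs F 2 = 1) :
    MeasurePreserving (fun p : Fin 3 → F => ![p 0 + δ₁ * p 1, -(p 0 - δ₁ * p 1), δ₁ * p 2 - 2⁻¹ * (p 0 + δ₁ * p 1) * (p 0 - δ₁ * p 1)])
      (Measure.pi fun _ : Fin 3 => μ) (Measure.pi fun _ : Fin 3 => μ) := by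
  haveI := secondCountableTopology_localField F
  have hM : normAbs F (!![(1 : F), δ₁, 0; -1, δ₁, 0; 0, 0, δ₁]).det = 1 := by
    rw [det_bigCellMatrix, map_mul, map_pow, hδ, h2, one_pow, one_mul]
  have hL := measurePreserving_mulVec_of_normAbs_det_eq_one μ (!![(1 : F), δ₁, 0; -1, δ₁, 0; 0, 0, δ₁]) hM
  have hφ : Measurable (Function.uncurry fun x y : F => 2⁻¹ * x * y) :=
    ((measurable_const.mul measurable_fst).mul measurable_snd)
  have hS := measurePreserving_shear_fin_three μ hφ
  have hcomp : (fun p : Fin 3 → F => ![p 0 + δ₁ * p 1, -(p 0 - δ₁ * p 1), δ₁ * p 2 - 2⁻¹ * (p 0 + δ₁ * p 1) * (p 0 - δ₁ * p 1)]) =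
      (fun p : Fin 3 → F => Function.update p 2 (p 2 + 2⁻¹ * p 0 * p 1)) ∘ (fun p : Fin 3 → F => !![(1 : F), δ₁, 0; -1, δ₁, 0; 0, 0, δ₁] *ᵥ p) := by
    funext p
    rw [Function.comp_apply, bigCellMatrix_mulVec]
    ext i
    fin_cases i
    · simp
    · simp
    · simp
      ring
  rw [hcomp]
  exact hS.comp hL

omit [ValuativeRel F] [TopologicalSpace F] [IsNonarchimedeanLocalField F] [MeasurableSpace F] [BorelSpace F] in
/-- The inverse change `Ψ(x, y, z) = (½(x − y), (2δ₁)⁻¹(x + y), δ₁⁻¹(z − ½ x y))` is a left inverse of `Φ` (`2, δ₁ ≠ 0`). [folklore] -/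
theorem bigCellChange_leftInverse {δ₁ : F} (hδ : δ₁ ≠ 0) (h2 : (2 : F) ≠ 0) :
    Function.LeftInverse
      (fun q : Fin 3 → F => ![2⁻¹ * (q 0 - q 1), (2 * δ₁)⁻¹ * (q 0 + q 1), δ₁⁻¹ * (q 2 - 2⁻¹ * q 0 * q 1)])
      (fun p : Fin 3 → F => ![p 0 + δ₁ * p 1, -(p 0 - δ₁ * p 1), δ₁ * p 2 - 2⁻¹ * (p 0 + δ₁ * p 1) * (p 0 - δ₁ * p 1)]) := by
  intro p
  ext i
  fin_cases i
  · simp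
    field_simp
    ring
  · simp
    field_simp
    ring
  · simp
    field_simp
    ring

omit [ValuativeRel F] [TopologicalSpace F] [IsNonarchimedeanLocalField F] [MeasurableSpace F] [BorelSpace F] in
/-- `Ψ` is also a right inverse of `Φ`. [folklore] -/
theorem bigCellChange_rightInverse {δ₁ : F} (hδ : δ₁ ≠ 0) (h2 : (2 : F) ≠ 0) :
    Function.RightInverse
      (fun q : Fin 3 → F => ![2⁻¹ * (q 0 - q 1), (2 * δ₁)⁻¹ * (q 0 + q 1), δ₁⁻¹ * (q 2 - 2⁻¹ * q 0 * q 1)])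
      (fun p : Fin 3 → F => ![p 0 + δ₁ * p 1, -(p 0 - δ₁ * p 1), δ₁ * p 2 - 2⁻¹ * (p 0 + δ₁ * p 1) * (p 0 - δ₁ * p 1)]) := by
  intro q
  ext i
  fin_cases i
  · simp
    field_simp
    ring
  · simp
    field_simp
    ring
  · simp
    field_simp
    ring

/-- **HEAD — CHANGE OF VARIABLES IN THE TRIPLE INTEGRAL.**  For a non-archimedean local field `F`, any additive Haar measure `μ`, and `δ₁ ∈ F` with `‖δ₁‖_F = ‖2‖_F = 1`:
for EVERY function `G` on `F³` (no measurability or integrability needed — `Φ` is a measure-preserving measurable equivalence),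
  `∫ p, G (a + δ₁ b, −(a − δ₁ b), δ₁ t − ½(a + δ₁ b)(a − δ₁ b)) dμ³(a, b, t) = ∫ p, G p dμ³`.
With ★ `K2E1IntertwiningLocalFactorU3HeightSplit.prod_placesOver_max_one_norm_height_eq_gl3_of_split` this turns the split local factor of the `U(2,1)` intertwining constant,
read in the base coordinates of ★ `AdelicProductIntegral` (`ι = Fin 3`), into the Gindikin–Karpelevich `GL₃` integral of ★ `K2E1GindikinKarpelevichSplitGL3`.
[cite: Tate1950, §2.2 Lemma 2.2.5] [cite: Langlands1971, §3] [cite: WeilBNT1967, Ch. II §5] -/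
theorem integral_comp_bigCellChange_eq {E : Type*} [NormedAddCommGroup E] [NormedSpace ℝ E] {δ₁ : F} (hδ : normAbs F δ₁ = 1) (h2 : normAbs F 2 = 1)
    (G : (Fin 3 → F) → E) :
    ∫ p, G ![p 0 + δ₁ * p 1, -(p 0 - δ₁ * p 1), δ₁ * p 2 - 2⁻¹ * (p 0 + δ₁ * p 1) * (p 0 - δ₁ * p 1)] ∂(Measure.pi fun _ : Fin 3 => μ) =
      ∫ p, G p ∂(Measure.pi fun _ : Fin 3 => μ) := by
  haveI := secondCountableTopology_localField F
  haveI := sigmaCompactSpace_of_isNonarchimedeanLocalField F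
  have hδ0 : δ₁ ≠ 0 := by
    intro h; rw [h, map_zero] at hδ; exact zero_ne_one hδ
  have h20 : (2 : F) ≠ 0 := by
    intro h; rw [h, map_zero] at h2; exact zero_ne_one h2
  -- `Φ` as a measurable equivalence (both directions are polynomial, hence continuous)
  have hcontΦ : Continuous (fun p : Fin 3 → F => ![p 0 + δ₁ * p 1, -(p 0 - δ₁ * p 1), δ₁ * p 2 - 2⁻¹ * (p 0 + δ₁ * p 1) * (p 0 - δ₁ * p 1)]) := by
    refine continuous_pi fun i => ?_
    fin_cases i
    · exact (continuous_apply 0).add (continuous_const.mul (continuous_apply 1))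
    · exact ((continuous_apply 0).sub (continuous_const.mul (continuous_apply 1))).neg
    · exact (continuous_const.mul (continuous_apply 2)).sub
        ((continuous_const.mul ((continuous_apply 0).add (continuous_const.mul (continuous_apply 1)))).mul
          ((continuous_apply 0).sub (continuous_const.mul (continuous_apply 1))))
  have hcontΨ : Continuous (fun q : Fin 3 → F => ![2⁻¹ * (q 0 - q 1), (2 * δ₁)⁻¹ * (q 0 + q 1), δ₁⁻¹ * (q 2 - 2⁻¹ * q 0 * q 1)]) := by
    refine continuous_pi fun i => ?_
    fin_cases i
    · exact continuous_const.mul ((continuous_apply 0).sub (continuous_apply 1))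
    · exact continuous_const.mul ((continuous_apply 0).add (continuous_apply 1))
    · exact continuous_const.mul ((continuous_apply 2).sub ((continuous_const.mul (continuous_apply 0)).mul (continuous_apply 1)))
  let Φe : (Fin 3 → F) ≃ᵐ (Fin 3 → F) :=
    { toFun := fun p => ![p 0 + δ₁ * p 1, -(p 0 - δ₁ * p 1), δ₁ * p 2 - 2⁻¹ * (p 0 + δ₁ * p 1) * (p 0 - δ₁ * p 1)]
      invFun := fun q => ![2⁻¹ * (q 0 - q 1), (2 * δ₁)⁻¹ * (q 0 + q 1), δ₁⁻¹ * (q 2 - 2⁻¹ * q 0 * q 1)]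
      left_inv := bigCellChange_leftInverse hδ0 h20
      right_inv := bigCellChange_rightInverse hδ0 h20
      measurable_toFun := hcontΦ.measurable
      measurable_invFun := hcontΨ.measurable }
  have hΦ : MeasurePreserving Φe (Measure.pi fun _ : Fin 3 => μ) (Measure.pi fun _ : Fin 3 => μ) := measurePreserving_bigCellChange μ hδ h2
  exact hΦ.integral_comp' G

end Summit.HodgeConjecture.HodgeConjecture.Cruxes.H413.K2E1BigCellCoordinateChangeGL3

end
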